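/-
Copyright (c) 2026 the pub-hodgecm-mathlib formalisation cell (harness21).  Prover seat hodgecm-mathlib-K2E2-p12 (g6): Track B «K2-LIT», ENGINE E1,
h413 = stmt-HodgeConjecture-24833; line `K2_E1_TraceFormulaBeta`, 5Res campaign «ENDGAME BY FAMILIES», ROADCARD §3′ amendment #2 (228)∕(234) of K2E1-plan (g7), deals (S2b)+(S2c):
the level idempotent `R(e_{K′})` and the `K_∞`-type projector `P_τ = ∫_K χ̄_τ(k) π(k) dk` — the inputs `hebe ∕ het ∕ hP ∕ hh` of ★ `K2E1PureTensorHeckeAlgebraU` (p860333).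
-/
import Summits.HodgeConjecture.HodgeConjecture.Theorems.K2E1PureTensorHeckeAlgebraU   -- ★ p860333: `restrict_comp_integratedOperator_comm`, `comp_integratedOperator_comm_of_forall` (+ ★ `IntegratedOperatorStar`)
import Literature.NumberTheory.Automorphic.IntegratedOperatorFixedVectors             -- ★ `integratedOperator_comp_apply_eq` (right translations), `…_eq_self_of_forall_mul_eq` (left∕right absorption)
import HarnessLib

/-!
# K2·E1 — `K2E1KTypeProjectorPureTensorU` (deals (S2b)+(S2c)): THE LEVEL IDEMPOTENT `R(e_{K′})` (absorption, `R(e)R(t) = R(t) = R(t)R(e)` for bi-`K′`-invariant `t`, `R(e)R(b)R(e) =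
# R(e⋆b⋆e)`) AND THE `K`-TYPE PROJECTOR `P_χ = ∫_K χ(k) π(k) dμ_K` (IDEMPOTENT, SELF-ADJOINT, COMMUTES WITH THE OTHER FACTOR AND ABSORBS `χ`-SPHERICAL `R₁(h)`)
# [Deitmar–Echterhoff Lemma 1.6.3, Prop. 6.2.1; Knapp VIII §3; Borel–Jacquet §4.1]

Track B ∕ K2-LIT, crux h413 = `stmt-HodgeConjecture-24833`, route of record `HCCMUnconditional`; cell `hodgecm-mathlib`, squad K2, ENGINE E1 (5Res campaign, M2 v2 §3′.1 (ii′), D5′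
proper).  THEOREMS ONLY (no `def`, no `instance`, no notation, no named-fact hypothesis, no `sorry`; default heartbeats); lane `--supports stmt-HodgeConjecture-24833 --as helper`
(count-neutral).  CLOSES NO SOCKET.  Supplies, BY NAME, the four inputs left abstract in ★ p860333 `compression_pureTensor` ∕ `commute_pureTensor_of_separate`:
* §1 (S2b) THE LEVEL IDEMPOTENT, for any representation `σ` of a group `Γ` (E1: `σ = π|_{G_f}`, `Γ = U(H)(𝔸_f)`), a subgroup `K′ ≤ Γ` and `e ∈ C_c(Γ)` VANISHING OFF `K′` WITH `∫ e dη = 1`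
  (E1: `e_{K′} = vol(K′)⁻¹·1_{K′}`, `K′` compact open): `integratedOperator_comp_eq_of_forall_apply_comp` — `R(e) ∘ T = T` whenever `σ(k) ∘ T = T` on `K′`; `comp_integratedOperator_eq_of_forall_comp_apply`
  — `T ∘ R(e) = T` whenever `T ∘ σ(k) = T` on `K′`; hence **`integratedOperator_level_comp_eq`** `R(e)R(t) = R(t)` (`t` left-`K′`-invariant, `η` left-invariant), **`integratedOperator_comp_level_eq`**
  `R(t)R(e) = R(t)` (`t` right-`K′`-invariant, `η` right-invariant), **`het_of_biinvariant`** `R(e)R(t) = R(t)R(e)`, **`level_comp_self`** `R(e)R(e) = R(e)` (`e` left-`K′`-invariant),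
  **`adjoint_level`** `R(e)† = R(e)` (`e* = e`), and the convolution witness **`exists_hebe`** `R(e)R(b)R(e) = R(e⋆(b⋆e))` (★ `integratedOperator_comp_integratedOperator` twice).
* §2 (S2c) THE `K`-TYPE PROJECTOR in the two-factor setting of ★ p860333 (`ι₁ : G₁ →* G`, `ι₂ : G₂ →* G` commuting; a compact `K` with `κ : K →* G₁`, a probability Haar measure `μ` on `K`,
  and `χ ∈ C_c(K)` MULTIPLICATIVE with `χ(1) = 1` — E1: `χ = conj τ` for a character `τ` of `K_∞`): `P := (π.restrict (ι₁.comp κ)).integratedOperator … μ χ = ∫_K χ(k) π(ι₁ κ k) dμ`;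
  `integratedOperator_comp_eq_self_of_eigen` ∕ `comp_integratedOperator_eq_self_of_eigen` (the averaging lemma: `P ∘ T = T` when `π(κk) ∘ T = χ(k⁻¹)•T`); **`kType_comp_self`** `P ∘ P = P`;
  **`adjoint_kType`** `P† = P` (`conj χ(k⁻¹) = χ(k)`, `μ` inversion-invariant); **`kType_comm_restrict`** `P ∘ π(ι₂ y) = π(ι₂ y) ∘ P` (the `hP` of ★ p860333); **`kType_comp_integratedOperator_eq`**
  `P ∘ R₁ h = R₁ h` for `h (κ k * x) = χ k * h x`, **`integratedOperator_comp_kType_eq`** `R₁ h ∘ P = R₁ h` for `h (x * κ k) = χ k * h x`; hence **`hh_of_spherical`**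
  `R₁ h ∘ P = P ∘ R₁ h` (the `hh` of ★ p860333) for `χ`-spherical `h` (E1: `(τ,τ)`-spherical, `e_τ ⋆ h = h = h ⋆ e_τ`).
HONEST LABEL: HC_CM is proved only modulo the 7 printed citations (2 remaining named inputs: hLiu418 = `stmt-HodgeConjecture-24832`, h413 = `stmt-HodgeConjecture-24833`) until rung 0
closes; this file asserts no named fact and closes no socket; count-neutral; unconditional.

## References
* [DeitmarEchterhoff2014] A. Deitmar, S. Echterhoff, *Principles of Harmonic Analysis* (2nd ed., 2014): Lemma 1.6.3, Prop. 6.2.1, Lemma 6.2.2; §7.4 (isotypic projections `P_τ`).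
* [Knapp1986] A. W. Knapp, *Representation Theory of Semisimple Groups* (1986): VIII §3 (`K`-types, `E_τ = d_τ ∫_K conj χ_τ(k) π(k) dk`).
* [BorelJacquet1979] A. Borel, H. Jacquet, PSPM 33.1 (1979): §4.1 (idempotents `e_{K′}` of the Hecke algebra).
* [Gelbart1975] S. Gelbart, *Automorphic Forms on Adele Groups* (1975): (10.12)–(10.13).
-/

set_option autoImplicit false
set_option linter.dupNamespace false -- the mandated namespace repeats `HodgeConjecture.HodgeConjecture`

noncomputable section

open MeasureTheory Filter Topology CompactlySupported
open Literature.NumberTheory.Automorphic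
open Summit.HodgeConjecture.HodgeConjecture.Cruxes.H413.K2E1PureTensorHeckeAlgebraU (restrict_comp_integratedOperator_comm comp_integratedOperator_comm_of_forall)
open scoped InnerProductSpace ComplexConjugate

namespace Summit.HodgeConjecture.HodgeConjecture.Cruxes.H413.K2E1KTypeProjectorPureTensorU

/-! ## §1 (S2b) The level idempotent `R(e)`, `e` supported in `K′` with `∫ e = 1` -/

section Level

variable {Γ V : Type*} [Group Γ] [TopologicalSpace Γ] [MeasurableSpace Γ] [BorelSpace Γ]
  [NormedAddCommGroup V] [InnerProductSpace ℂ V] [CompleteSpace V]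
  (σ : ContRepresentation ℂ Γ V) (hu : σ.IsUnitary) (hc : σ.IsStronglyContinuous) (η : Measure Γ) [IsFiniteMeasureOnCompacts η]
  (K' : Subgroup Γ) (e : C_c(Γ, ℂ)) (he0 : ∀ x, x ∉ K' → e x = 0) (he1 : ∫ x, e x ∂η = 1)

include he0 he1 in
/-- **`R(e) ∘ T = T` WHEN `σ(k) ∘ T = T` FOR `k ∈ K′`** (`e` vanishes off `K′`, `∫ e dη = 1`): `R(e)(Tv) = ∫ e(x) σ(x) T v = ∫ e(x) • T v = T v`. [cite: DeitmarEchterhoff2014, Lemma 1.6.3] -/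
theorem integratedOperator_comp_eq_of_forall_apply_comp (T : V →L[ℂ] V) (hT : ∀ k ∈ K', σ k ∘L T = T) :
    σ.integratedOperator hu hc η e ∘L T = T := by
  ext v
  rw [ContinuousLinearMap.comp_apply, ContRepresentation.integratedOperator_apply]
  have h : (fun x => e x • σ x (T v)) = fun x => e x • T v := by
    funext x
    by_cases hx : x ∈ K'
    · rw [← ContinuousLinearMap.comp_apply (σ x) T, hT x hx]
    · rw [he0 x hx, zero_smul, zero_smul]
  rw [h, integral_smul_const, he1, one_smul]

include he0 he1 in
/-- **`T ∘ R(e) = T` WHEN `T ∘ σ(k) = T` FOR `k ∈ K′`**: `T(R(e)v) = ∫ e(x) T σ(x) v = ∫ e(x) • T v = T v`. [cite: DeitmarEchterhoff2014, Lemma 1.6.3] -/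
theorem comp_integratedOperator_eq_of_forall_comp_apply (T : V →L[ℂ] V) (hT : ∀ k ∈ K', T ∘L σ k = T) :
    T ∘L σ.integratedOperator hu hc η e = T := by
  ext v
  rw [ContinuousLinearMap.comp_apply, ContRepresentation.integratedOperator_apply,
    ← ContinuousLinearMap.integral_comp_comm T (ContRepresentation.integrable_smul_apply hc η e v)]
  have h : (fun x => T (e x • σ x v)) = fun x => e x • T v := by
    funext x
    rw [ContinuousLinearMap.map_smul]
    by_cases hx : x ∈ K'
    · rw [← ContinuousLinearMap.comp_apply T (σ x), hT x hx]
    · rw [he0 x hx, zero_smul, zero_smul]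
  rw [h, integral_smul_const, he1, one_smul]

include he0 he1 in
/-- **`R(e) ∘ R(t) = R(t)` for `t` LEFT `K′`-INVARIANT** (`η` left-invariant; ★ `apply_comp_integratedOperator_eq_self_of_forall_mul_eq`). [cite: DeitmarEchterhoff2014, Lemma 1.6.3] [cite: BorelJacquet1979, §4.1] -/
theorem integratedOperator_level_comp_eq [MeasurableMul Γ] [η.IsMulLeftInvariant] (t : C_c(Γ, ℂ)) (ht : ∀ k ∈ K', ∀ x, t (k * x) = t x) :
    σ.integratedOperator hu hc η e ∘L σ.integratedOperator hu hc η t = σ.integratedOperator hu hc η t :=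
  integratedOperator_comp_eq_of_forall_apply_comp σ hu hc η K' e he0 he1 _ fun _ hk =>
    ContRepresentation.apply_comp_integratedOperator_eq_self_of_forall_mul_eq hu hc η K' t ht hk

include he0 he1 in
/-- **`R(t) ∘ R(e) = R(t)` for `t` RIGHT `K′`-INVARIANT** (`η` right-invariant; ★ `integratedOperator_comp_apply_eq_self_of_forall_mul_eq`). [cite: DeitmarEchterhoff2014, Lemma 1.6.3] [cite: BorelJacquet1979, §4.1] -/
theorem integratedOperator_comp_level_eq [MeasurableMul Γ] [η.IsMulRightInvariant] (t : C_c(Γ, ℂ)) (ht : ∀ k ∈ K', ∀ x, t (x * k) = t x) :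
    σ.integratedOperator hu hc η t ∘L σ.integratedOperator hu hc η e = σ.integratedOperator hu hc η t :=
  comp_integratedOperator_eq_of_forall_comp_apply σ hu hc η K' e he0 he1 _ fun _ hk =>
    ContRepresentation.integratedOperator_comp_apply_eq_self_of_forall_mul_eq hu hc η K' t ht hk

include he0 he1 in
/-- **`het`: `R(e) ∘ R(t) = R(t) ∘ R(e)` for BI-`K′`-INVARIANT `t`** (both equal `R(t)`; `η` two-sided invariant, e.g. `G_f` unimodular) — the hypothesis `het` of ★ p860333
`commute_pureTensor_of_separate`. [cite: BorelJacquet1979, §4.1] -/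
theorem het_of_biinvariant [MeasurableMul Γ] [η.IsMulLeftInvariant] [η.IsMulRightInvariant] (t : C_c(Γ, ℂ))
    (htl : ∀ k ∈ K', ∀ x, t (k * x) = t x) (htr : ∀ k ∈ K', ∀ x, t (x * k) = t x) :
    σ.integratedOperator hu hc η e ∘L σ.integratedOperator hu hc η t = σ.integratedOperator hu hc η t ∘L σ.integratedOperator hu hc η e := by
  rw [integratedOperator_level_comp_eq σ hu hc η K' e he0 he1 t htl, integratedOperator_comp_level_eq σ hu hc η K' e he0 he1 t htr]

include he0 he1 in
/-- **`R(e)` IS IDEMPOTENT** when `e` is moreover left-`K′`-invariant (E1: `e_{K′} = vol(K′)⁻¹ 1_{K′}`). [cite: BorelJacquet1979, §4.1] -/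
theorem level_comp_self [MeasurableMul Γ] [η.IsMulLeftInvariant] (heK : ∀ k ∈ K', ∀ x, e (k * x) = e x) :
    σ.integratedOperator hu hc η e ∘L σ.integratedOperator hu hc η e = σ.integratedOperator hu hc η e :=
  integratedOperator_level_comp_eq σ hu hc η K' e he0 he1 e heK

omit [BorelSpace Γ] in
/-- **`R(e)` IS SELF-ADJOINT** when `e* = e` (`conj e(x⁻¹) = e(x)`: real and inversion-symmetric, as `vol(K′)⁻¹ 1_{K′}`), `η` inversion-invariant (★ `adjoint_integratedOperator`).
[cite: DeitmarEchterhoff2014, Prop. 6.2.1] -/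
theorem adjoint_level [BorelSpace Γ] [MeasurableInv Γ] [η.IsInvInvariant] (hestar : ∀ x, mulStar (⇑e) x = e x) :
    ContinuousLinearMap.adjoint (σ.integratedOperator hu hc η e) = σ.integratedOperator hu hc η e :=
  ContRepresentation.adjoint_integratedOperator hu hc η e e fun x => (hestar x).symm

/-- **`hebe`: `R(e) ∘ R(b) ∘ R(e) = R(e ⋆ (b ⋆ e))`** with an explicit `C_c` witness (★ `integratedOperator_comp_integratedOperator` twice; `η` left-invariant, s-finite, `Γ` second
countable) — the hypothesis `hebe` of ★ p860333 `compression_pureTensor`. [cite: DeitmarEchterhoff2014, Prop. 6.2.1] -/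
theorem exists_hebe [IsTopologicalGroup Γ] [LocallyCompactSpace Γ] [SecondCountableTopology Γ] [SFinite η] [η.IsMulLeftInvariant] (b : C_c(Γ, ℂ)) :
    ∃ ebe : C_c(Γ, ℂ), (∀ x, ebe x = mulConv η (⇑e) (mulConv η (⇑b) (⇑e)) x) ∧
      σ.integratedOperator hu hc η e ∘L σ.integratedOperator hu hc η b ∘L σ.integratedOperator hu hc η e = σ.integratedOperator hu hc η ebe := by
  obtain ⟨be, hbe⟩ := exists_compactlySupported_mulConv η b e
  obtain ⟨ebe, hebe⟩ := exists_compactlySupported_mulConv η e be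
  have hbe' : (⇑be) = mulConv η (⇑b) (⇑e) := funext hbe
  refine ⟨ebe, fun x => by rw [hebe, hbe'], ?_⟩
  rw [ContRepresentation.integratedOperator_comp_integratedOperator hu hc η b e be hbe, ContRepresentation.integratedOperator_comp_integratedOperator hu hc η e be ebe hebe]

end Level

/-! ## §2 (S2c) The `K`-type projector `P = ∫_K χ(k) π(ι₁ κ k) dμ_K` -/

section KType

variable {G G₁ G₂ K V : Type*} [Group G] [TopologicalSpace G] [Group G₁] [TopologicalSpace G₁] [Group G₂]
  [Group K] [TopologicalSpace K] [MeasurableSpace K] [BorelSpace K]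
  [NormedAddCommGroup V] [InnerProductSpace ℂ V] [CompleteSpace V]
  (π : ContRepresentation ℂ G V) (hu : π.IsUnitary) (hc : π.IsStronglyContinuous)
  (ι₁ : G₁ →* G) (hι₁ : Continuous ι₁) (ι₂ : G₂ →* G) (κ : K →* G₁) (hκ : Continuous κ)
  (μ : Measure K) [IsFiniteMeasureOnCompacts μ] (χ : C_c(K, ℂ))

omit [MeasurableSpace K] [BorelSpace K] in
/-- `χ(k) χ(k⁻¹) = 1` for a multiplicative `χ` with `χ(1) = 1`. [folklore] -/
theorem chi_mul_chi_inv (hχmul : ∀ k l, χ (k * l) = χ k * χ l) (hχone : χ 1 = 1) (k : K) : χ k * χ k⁻¹ = 1 := by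
  rw [← hχmul, mul_inv_cancel, hχone]

/-- **THE AVERAGING LEMMA**: if `π(ι₁ κ k) ∘ T = χ(k⁻¹) • T` for all `k ∈ K` then `P ∘ T = T`, `P = ∫_K χ(k) π(ι₁ κ k) dμ` (`μ` a probability measure, `χ` multiplicative, `χ(1) = 1`):
`P(Tv) = ∫ χ(k)χ(k⁻¹) • T v dμ = T v`. [cite: Knapp1986, VIII §3] [cite: DeitmarEchterhoff2014, §7.4] -/
theorem integratedOperator_comp_eq_self_of_eigen [IsProbabilityMeasure μ] (hχmul : ∀ k l, χ (k * l) = χ k * χ l) (hχone : χ 1 = 1)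
    (T : V →L[ℂ] V) (hT : ∀ k : K, π (ι₁ (κ k)) ∘L T = χ k⁻¹ • T) :
    (π.restrict (ι₁.comp κ)).integratedOperator (hu.restrict (ι₁.comp κ)) (hc.restrict (ι₁.comp κ) (hι₁.comp hκ)) μ χ ∘L T = T := by
  ext v
  rw [ContinuousLinearMap.comp_apply, ContRepresentation.integratedOperator_apply]
  have h : (fun k => χ k • (π.restrict (ι₁.comp κ)) k (T v)) = fun _ => T v := by
    funext k
    rw [ContRepresentation.restrict_apply, MonoidHom.comp_apply, ← ContinuousLinearMap.comp_apply (π (ι₁ (κ k))) T, hT k, FunLike.coe_smul, Pi.smul_apply, smul_smul,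
      chi_mul_chi_inv χ hχmul hχone, one_smul]
  rw [h, integral_const, probReal_univ, one_smul]

/-- **THE AVERAGING LEMMA, RIGHT VERSION**: if `T ∘ π(ι₁ κ k) = χ(k⁻¹) • T` for all `k` then `T ∘ P = T`. [cite: Knapp1986, VIII §3] [cite: DeitmarEchterhoff2014, §7.4] -/
theorem comp_integratedOperator_eq_self_of_eigen [IsProbabilityMeasure μ] (hχmul : ∀ k l, χ (k * l) = χ k * χ l) (hχone : χ 1 = 1)
    (T : V →L[ℂ] V) (hT : ∀ k : K, T ∘L π (ι₁ (κ k)) = χ k⁻¹ • T) :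
    T ∘L (π.restrict (ι₁.comp κ)).integratedOperator (hu.restrict (ι₁.comp κ)) (hc.restrict (ι₁.comp κ) (hι₁.comp hκ)) μ χ = T := by
  ext v
  rw [ContinuousLinearMap.comp_apply, ContRepresentation.integratedOperator_apply,
    ← ContinuousLinearMap.integral_comp_comm T (ContRepresentation.integrable_smul_apply (hc.restrict (ι₁.comp κ) (hι₁.comp hκ)) μ χ v)]
  have h : (fun k => T (χ k • (π.restrict (ι₁.comp κ)) k v)) = fun _ => T v := by
    funext k
    rw [ContinuousLinearMap.map_smul, ContRepresentation.restrict_apply, MonoidHom.comp_apply, ← ContinuousLinearMap.comp_apply T (π (ι₁ (κ k))), hT k,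
      FunLike.coe_smul, Pi.smul_apply, smul_smul, chi_mul_chi_inv χ hχmul hχone, one_smul]
  rw [h, integral_const, probReal_univ, one_smul]

/-- `π(ι₁ κ k) ∘ P = χ(k⁻¹) • P`: translating the kernel `χ` by `k` multiplies it by `χ(k⁻¹)` (★ `apply_comp_integratedOperator`, ★ `integratedOperator_smul`; `μ` left-invariant).
[cite: Knapp1986, VIII §3] -/
theorem apply_comp_kType [MeasurableMul K] [μ.IsMulLeftInvariant] (hχmul : ∀ k l, χ (k * l) = χ k * χ l) (k : K) :
    π (ι₁ (κ k)) ∘L (π.restrict (ι₁.comp κ)).integratedOperator (hu.restrict (ι₁.comp κ)) (hc.restrict (ι₁.comp κ) (hι₁.comp hκ)) μ χ =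
      χ k⁻¹ • (π.restrict (ι₁.comp κ)).integratedOperator (hu.restrict (ι₁.comp κ)) (hc.restrict (ι₁.comp κ) (hι₁.comp hκ)) μ χ := by
  have h := ContRepresentation.apply_comp_integratedOperator (hu.restrict (ι₁.comp κ)) (hc.restrict (ι₁.comp κ) (hι₁.comp hκ)) μ k χ (χ k⁻¹ • χ)
    (fun x => by rw [CompactlySupportedContinuousMap.smul_apply, smul_eq_mul, ← hχmul])
  rw [ContRepresentation.restrict_apply, MonoidHom.comp_apply] at h
  rw [h, ContRepresentation.integratedOperator_smul]

/-- **`P` IS IDEMPOTENT: `P ∘ P = P`** (`μ` a left-invariant probability measure, `χ` multiplicative with `χ(1) = 1`). [cite: Knapp1986, VIII §3] [cite: DeitmarEchterhoff2014, §7.4] -/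
theorem kType_comp_self [IsProbabilityMeasure μ] [MeasurableMul K] [μ.IsMulLeftInvariant] (hχmul : ∀ k l, χ (k * l) = χ k * χ l) (hχone : χ 1 = 1) :
    (π.restrict (ι₁.comp κ)).integratedOperator (hu.restrict (ι₁.comp κ)) (hc.restrict (ι₁.comp κ) (hι₁.comp hκ)) μ χ ∘L
        (π.restrict (ι₁.comp κ)).integratedOperator (hu.restrict (ι₁.comp κ)) (hc.restrict (ι₁.comp κ) (hι₁.comp hκ)) μ χ =
      (π.restrict (ι₁.comp κ)).integratedOperator (hu.restrict (ι₁.comp κ)) (hc.restrict (ι₁.comp κ) (hι₁.comp hκ)) μ χ :=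
  integratedOperator_comp_eq_self_of_eigen π hu hc ι₁ hι₁ κ hκ μ χ hχmul hχone
    ((π.restrict (ι₁.comp κ)).integratedOperator (hu.restrict (ι₁.comp κ)) (hc.restrict (ι₁.comp κ) (hι₁.comp hκ)) μ χ)
    (apply_comp_kType π hu hc ι₁ hι₁ κ hκ μ χ hχmul)

/-- **`P` IS SELF-ADJOINT** when `conj χ(k⁻¹) = χ(k)` (a unitary character: `χ* = χ`) and `μ` is inversion-invariant (★ `adjoint_integratedOperator`). [cite: DeitmarEchterhoff2014, Prop. 6.2.1] -/
theorem adjoint_kType [MeasurableInv K] [μ.IsInvInvariant] (hχinv : ∀ k, conj (χ k⁻¹) = χ k) :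
    ContinuousLinearMap.adjoint ((π.restrict (ι₁.comp κ)).integratedOperator (hu.restrict (ι₁.comp κ)) (hc.restrict (ι₁.comp κ) (hι₁.comp hκ)) μ χ) =
      (π.restrict (ι₁.comp κ)).integratedOperator (hu.restrict (ι₁.comp κ)) (hc.restrict (ι₁.comp κ) (hι₁.comp hκ)) μ χ :=
  ContRepresentation.adjoint_integratedOperator (hu.restrict (ι₁.comp κ)) (hc.restrict (ι₁.comp κ) (hι₁.comp hκ)) μ χ χ fun k => (hχinv k).symm

/-- **`P` COMMUTES WITH THE OTHER FACTOR: `P ∘ π(ι₂ y) = π(ι₂ y) ∘ P`** when the images of `ι₁`, `ι₂` commute (★ p860333 `restrict_comp_integratedOperator_comm` for `ι₁ ∘ κ`) — the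
hypothesis `hP` of ★ p860333 `compression_pureTensor` ∕ `commute_pureTensor_of_separate`. [cite: Gelbart1975, (10.12)–(10.13)] [cite: BorelJacquet1979, §4.1] -/
theorem kType_comm_restrict (hcomm : ∀ (x : G₁) (y : G₂), ι₁ x * ι₂ y = ι₂ y * ι₁ x) (y : G₂) :
    (π.restrict (ι₁.comp κ)).integratedOperator (hu.restrict (ι₁.comp κ)) (hc.restrict (ι₁.comp κ) (hι₁.comp hκ)) μ χ ∘L π (ι₂ y) =
      π (ι₂ y) ∘L (π.restrict (ι₁.comp κ)).integratedOperator (hu.restrict (ι₁.comp κ)) (hc.restrict (ι₁.comp κ) (hι₁.comp hκ)) μ χ :=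
  (restrict_comp_integratedOperator_comm π hu hc (ι₁.comp κ) (hι₁.comp hκ) ι₂ μ (fun k y' => hcomm (κ k) y') y χ).symm

section Arch

variable [MeasurableSpace G₁] [BorelSpace G₁] (η₁ : Measure G₁) [IsFiniteMeasureOnCompacts η₁]

/-- **`P ∘ R₁ h = R₁ h` for `h` LEFT `χ`-EQUIVARIANT** (`h (κ k * x) = χ k * h x`; `η₁` left-invariant): `π(ι₁ κ k) R₁ h = R₁(λ_k h) = χ(k⁻¹) • R₁ h` (`(λ_k h)(x) = h(κ k⁻¹ · x)`), then
the averaging lemma.  E1: `χ = conj τ`, `h` `(τ,τ)`-spherical ⇒ `e_τ ⋆ h = h`. [cite: Knapp1986, VIII §3] -/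
theorem kType_comp_integratedOperator_eq [IsProbabilityMeasure μ] [MeasurableMul G₁] [η₁.IsMulLeftInvariant] (hχmul : ∀ k l, χ (k * l) = χ k * χ l) (hχone : χ 1 = 1)
    (h : C_c(G₁, ℂ)) (hleft : ∀ (k : K) (x : G₁), h (κ k * x) = χ k * h x) :
    (π.restrict (ι₁.comp κ)).integratedOperator (hu.restrict (ι₁.comp κ)) (hc.restrict (ι₁.comp κ) (hι₁.comp hκ)) μ χ ∘L
        (π.restrict ι₁).integratedOperator (hu.restrict ι₁) (hc.restrict ι₁ hι₁) η₁ h =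
      (π.restrict ι₁).integratedOperator (hu.restrict ι₁) (hc.restrict ι₁ hι₁) η₁ h := by
  refine integratedOperator_comp_eq_self_of_eigen π hu hc ι₁ hι₁ κ hκ μ χ hχmul hχone _ fun k => ?_
  have e := ContRepresentation.apply_comp_integratedOperator (hu.restrict ι₁) (hc.restrict ι₁ hι₁) η₁ (κ k) h (χ k⁻¹ • h)
    (fun x => by rw [CompactlySupportedContinuousMap.smul_apply, smul_eq_mul, ← map_inv, hleft])
  rw [ContRepresentation.restrict_apply] at e
  rw [e, ContRepresentation.integratedOperator_smul]

/-- **`R₁ h ∘ P = R₁ h` for `h` RIGHT `χ`-EQUIVARIANT** (`h (x * κ k) = χ k * h x`; `η₁` right-invariant): `R₁ h ∘ π(ι₁ κ k) = R₁(ρ_k h) = χ(k⁻¹) • R₁ h` (★ `integratedOperator_comp_apply_eq`,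
`(ρ_k h)(x) = h(x · κ k⁻¹)`).  E1: `h ⋆ e_τ = h`. [cite: Knapp1986, VIII §3] -/
theorem integratedOperator_comp_kType_eq [IsProbabilityMeasure μ] [MeasurableMul G₁] [η₁.IsMulRightInvariant] (hχmul : ∀ k l, χ (k * l) = χ k * χ l) (hχone : χ 1 = 1)
    (h : C_c(G₁, ℂ)) (hright : ∀ (k : K) (x : G₁), h (x * κ k) = χ k * h x) :
    (π.restrict ι₁).integratedOperator (hu.restrict ι₁) (hc.restrict ι₁ hι₁) η₁ h ∘L
        (π.restrict (ι₁.comp κ)).integratedOperator (hu.restrict (ι₁.comp κ)) (hc.restrict (ι₁.comp κ) (hι₁.comp hκ)) μ χ =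
      (π.restrict ι₁).integratedOperator (hu.restrict ι₁) (hc.restrict ι₁ hι₁) η₁ h := by
  refine comp_integratedOperator_eq_self_of_eigen π hu hc ι₁ hι₁ κ hκ μ χ hχmul hχone _ fun k => ?_
  have e := ContRepresentation.integratedOperator_comp_apply_eq (hu.restrict ι₁) (hc.restrict ι₁ hι₁) η₁ (κ k) h (χ k⁻¹ • h)
    (fun x => by rw [CompactlySupportedContinuousMap.smul_apply, smul_eq_mul, ← map_inv, hright])
  rw [ContRepresentation.restrict_apply] at e
  rw [e, ContRepresentation.integratedOperator_smul]

/-- **`hh`: `R₁ h ∘ P = P ∘ R₁ h` FOR `χ`-SPHERICAL `h`** (two-sided `χ`-equivariant; both products equal `R₁ h`; `η₁` two-sided invariant) — the hypothesis `hh` of ★ p860333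
`commute_pureTensor_of_separate` (E1: `h` `(τ,τ)`-spherical, `χ = conj τ`, `P = P_τ`). [cite: Knapp1986, VIII §3] -/
theorem hh_of_spherical [IsProbabilityMeasure μ] [MeasurableMul G₁] [η₁.IsMulLeftInvariant] [η₁.IsMulRightInvariant] (hχmul : ∀ k l, χ (k * l) = χ k * χ l) (hχone : χ 1 = 1)
    (h : C_c(G₁, ℂ)) (hleft : ∀ (k : K) (x : G₁), h (κ k * x) = χ k * h x) (hright : ∀ (k : K) (x : G₁), h (x * κ k) = χ k * h x) :
    (π.restrict ι₁).integratedOperator (hu.restrict ι₁) (hc.restrict ι₁ hι₁) η₁ h ∘L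
        (π.restrict (ι₁.comp κ)).integratedOperator (hu.restrict (ι₁.comp κ)) (hc.restrict (ι₁.comp κ) (hι₁.comp hκ)) μ χ =
      (π.restrict (ι₁.comp κ)).integratedOperator (hu.restrict (ι₁.comp κ)) (hc.restrict (ι₁.comp κ) (hι₁.comp hκ)) μ χ ∘L
        (π.restrict ι₁).integratedOperator (hu.restrict ι₁) (hc.restrict ι₁ hι₁) η₁ h := by
  rw [integratedOperator_comp_kType_eq π hu hc ι₁ hι₁ κ hκ μ χ η₁ hχmul hχone h hright,
    kType_comp_integratedOperator_eq π hu hc ι₁ hι₁ κ hκ μ χ η₁ hχmul hχone h hleft]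

end Arch

section Fin

variable [TopologicalSpace G₂] [MeasurableSpace G₂] [BorelSpace G₂] (hι₂ : Continuous ι₂) (η₂ : Measure G₂) [IsFiniteMeasureOnCompacts η₂]

/-- **THE FULL PROJECTOR `P ∘ R₂ e` COMMUTES INTERNALLY**: `P ∘ R₂ b = R₂ b ∘ P` for every `b ∈ C_c(G₂)` (★ p860333 `comp_integratedOperator_comm_of_forall` with `kType_comm_restrict`), so
`(P ∘ R₂ e)² = P² ∘ (R₂ e)²` and `(P ∘ R₂ e)† = (R₂ e)† ∘ P†` assemble from §1–§2. [cite: Knapp1986, VIII §3] [cite: BorelJacquet1979, §4.1] -/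
theorem kType_comm_integratedOperator (hcomm : ∀ (x : G₁) (y : G₂), ι₁ x * ι₂ y = ι₂ y * ι₁ x) (b : C_c(G₂, ℂ)) :
    (π.restrict (ι₁.comp κ)).integratedOperator (hu.restrict (ι₁.comp κ)) (hc.restrict (ι₁.comp κ) (hι₁.comp hκ)) μ χ ∘L
        (π.restrict ι₂).integratedOperator (hu.restrict ι₂) (hc.restrict ι₂ hι₂) η₂ b =
      (π.restrict ι₂).integratedOperator (hu.restrict ι₂) (hc.restrict ι₂ hι₂) η₂ b ∘L
        (π.restrict (ι₁.comp κ)).integratedOperator (hu.restrict (ι₁.comp κ)) (hc.restrict (ι₁.comp κ) (hι₁.comp hκ)) μ χ :=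
  comp_integratedOperator_comm_of_forall π hu hc ι₂ hι₂ η₂ _ (kType_comm_restrict π hu hc ι₁ hι₁ ι₂ κ hκ μ χ hcomm) b

end Fin

end KType

end Summit.HodgeConjecture.HodgeConjecture.Cruxes.H413.K2E1KTypeProjectorPureTensorU

end
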